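import Summits.HubbardSuperconductivity.HubbardSuperconductivity.Theorems.NodalDiracTwistTwistCalibrationBdGDiagonal

/-!
# Route `NodalDiracTwist` — support `TwistCalibrationBdG`: sector ground states of the BdG family

Fifth helper file for stmt-HubbardSuperconductivity-1625: the spectrum of `H(φ)` on `ker S^z` read off
the diagonal form. The band energies `Σ_{o' ∈ s} e(o')` are minimised by the filled lower band `s = D↓`
(`sum_bdgModeEnergy_spinDownOrbitals_le`, minimisers characterised by `sum_bdgModeEnergy_eq_iff`);
`Re⟨ψ, Hψ⟩ = Σ_s (Σ_{o'∈s} e)|Vψ(s)|² + (Σξ)‖ψ‖²`; **`minEnergyOn H (ker S^z) = Σ_{D↓} e + Σ_k ξ_k`**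
(`minEnergyOn_sourcedSpinTwisted_ker_spinZ`); the eigenvectors `Vᴴ e_s`; ground states are the `ψ`
with `Vψ` supported on minimisers (`sourcedSpinTwisted_mulVec_eq_smul_iff`); **uniqueness** when no
Bogoliubov mode has zero energy (`eq_smul_bcs_of_forall_twistNambuZ_ne_zero`) and **two orthogonal
sector ground states** at a zero-energy mode (`exists_orthogonal_ground_states_of_twistNambuZ_eq_zero`).

Sources: de Gennes (1966) Ch. 5 (BCS ground state and quasiparticle configurations). No definitions.
-/

-- the mandated namespace `Summit.<Summit>.<Problem>.Theorems` repeats `HubbardSuperconductivity`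
-- (single-problem summit, D-0017), which the `dupNamespace` linter flags on every declaration
set_option linter.dupNamespace false

namespace Summit.HubbardSuperconductivity.HubbardSuperconductivity.Theorems.NodalDiracTwist

open Matrix Finset Literature.Probability.LatticeModels Literature.MathematicalPhysics.QuantumLattice
open scoped ComplexConjugate

variable {d L : ℕ} [NeZero L]

/-! ## Part II: spectral conclusions -/

section EnergySums

omit [NeZero L] in
/-- The mode energies of the two bands at a site label: `e(x,↑) = |z_{x̄}|`, `e(x,↓) = -|z_{x̄}|`.
[folklore] -/
theorem bdgModeEnergy_orb (μ₀ h : ℝ) (φ : Fin d → ℝ) (x : FermionTorus d L) (σ : Fin 2) :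
    bdgModeEnergy L μ₀ h φ (orb x σ) =
      if σ = 0 then ‖twistNambuZ L μ₀ h φ x.toTorusSite‖ else -‖twistNambuZ L μ₀ h φ x.toTorusSite‖ :=
  rfl

omit [NeZero L] in
/-- The band energy of a set of mode labels, resolved over sites:
`Σ_{o' ∈ s} e(o') = Σ_x ([x↑ ∈ s] - [x↓ ∈ s]) |z_{x̄}|`. [folklore] -/
theorem sum_bdgModeEnergy_eq (μ₀ h : ℝ) (φ : Fin d → ℝ) (s : Finset (Orb (FermionTorus d L))) :
    ∑ o' ∈ s, bdgModeEnergy L μ₀ h φ o' =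
      ∑ x : FermionTorus d L, ((if orb x 0 ∈ s then ‖twistNambuZ L μ₀ h φ x.toTorusSite‖ else 0) -
        (if orb x 1 ∈ s then ‖twistNambuZ L μ₀ h φ x.toTorusSite‖ else 0)) := by
  calc ∑ o' ∈ s, bdgModeEnergy L μ₀ h φ o'
      = ∑ o' ∈ Finset.univ ∩ s, bdgModeEnergy L μ₀ h φ o' := by rw [Finset.univ_inter]
    _ = ∑ o', (if o' ∈ s then bdgModeEnergy L μ₀ h φ o' else 0) := (Finset.sum_ite_mem _ _ _).symm
    _ = ∑ x : FermionTorus d L, ∑ σ : Fin 2,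
          (if orb x σ ∈ s then bdgModeEnergy L μ₀ h φ (orb x σ) else 0) := sum_orb_eq_sum_sum _
    _ = _ := by
        refine Finset.sum_congr rfl fun x _ => ?_
        rw [Fin.sum_univ_two, bdgModeEnergy_orb, bdgModeEnergy_orb, if_pos rfl,
          if_neg (show (1 : Fin 2) ≠ 0 from by decide), sub_eq_add_neg]
        congr 1
        split_ifs <;> simp

omit [NeZero L] in
/-- The band energy of the filled lower band `D↓`: `Σ_{o' ∈ D↓} e(o') = -Σ_x |z_{x̄}|`. [folklore] -/
theorem sum_bdgModeEnergy_spinDownOrbitals (μ₀ h : ℝ) (φ : Fin d → ℝ) :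
    ∑ o' ∈ (spinDownOrbitals : Finset (Orb (FermionTorus d L))), bdgModeEnergy L μ₀ h φ o' =
      -∑ x : FermionTorus d L, ‖twistNambuZ L μ₀ h φ x.toTorusSite‖ := by
  rw [sum_bdgModeEnergy_eq, ← Finset.sum_neg_distrib]
  refine Finset.sum_congr rfl fun x _ => ?_
  rw [if_neg (orb_zero_not_mem_spinDownOrbitals x), if_pos (orb_one_mem_spinDownOrbitals x), zero_sub]

omit [NeZero L] in
/-- **The filled lower band minimises the band energy**: `Σ_{o' ∈ D↓} e(o') ≤ Σ_{o' ∈ s} e(o')` for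
every set `s` of mode labels. [folklore] -/
theorem sum_bdgModeEnergy_spinDownOrbitals_le (μ₀ h : ℝ) (φ : Fin d → ℝ)
    (s : Finset (Orb (FermionTorus d L))) :
    ∑ o' ∈ (spinDownOrbitals : Finset (Orb (FermionTorus d L))), bdgModeEnergy L μ₀ h φ o' ≤
      ∑ o' ∈ s, bdgModeEnergy L μ₀ h φ o' := by
  rw [sum_bdgModeEnergy_spinDownOrbitals, sum_bdgModeEnergy_eq, ← Finset.sum_neg_distrib]
  refine Finset.sum_le_sum fun x _ => ?_
  have h0 := norm_nonneg (twistNambuZ L μ₀ h φ x.toTorusSite)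
  split_ifs <;> linarith

omit [NeZero L] in
/-- **The minimisers**: `Σ_{o' ∈ s} e(o') = Σ_{o' ∈ D↓} e(o')` iff `s` differs from the filled lower
band only at zero-energy modes: every upper label `(x,↑) ∈ s` and every missing lower label
`(x,↓) ∉ s` has `z_{x̄} = 0`. [folklore] -/
theorem sum_bdgModeEnergy_eq_iff (μ₀ h : ℝ) (φ : Fin d → ℝ) (s : Finset (Orb (FermionTorus d L))) :
    ∑ o' ∈ s, bdgModeEnergy L μ₀ h φ o' =
        ∑ o' ∈ (spinDownOrbitals : Finset (Orb (FermionTorus d L))), bdgModeEnergy L μ₀ h φ o' ↔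
      ∀ x : FermionTorus d L, (orb x 0 ∈ s → twistNambuZ L μ₀ h φ x.toTorusSite = 0) ∧
        (orb x 1 ∉ s → twistNambuZ L μ₀ h φ x.toTorusSite = 0) := by
  rw [sum_bdgModeEnergy_spinDownOrbitals, sum_bdgModeEnergy_eq, ← Finset.sum_neg_distrib, eq_comm,
    Finset.sum_eq_sum_iff_of_le]
  · simp only [Finset.mem_univ, forall_true_left]
    refine forall_congr' fun x => ?_
    have h0 := norm_nonneg (twistNambuZ L μ₀ h φ x.toTorusSite)
    rw [← norm_eq_zero]
    constructor
    · intro hx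
      constructor
      · intro h1
        rw [if_pos h1] at hx
        split_ifs at hx <;> linarith
      · intro h1
        rw [if_neg h1] at hx
        split_ifs at hx <;> linarith
    · rintro ⟨h1, h2⟩
      by_cases ha : orb x 0 ∈ s <;> by_cases hb : orb x 1 ∈ s <;> simp only [ha, hb, if_true, if_false]
      · rw [h1 ha]; simp
      · rw [h1 ha]; simp
      · simp
      · rw [h2 hb]; simp
  · intro x _
    have h0 := norm_nonneg (twistNambuZ L μ₀ h φ x.toTorusSite)
    split_ifs <;> linarith

/-- `|D↓| = |Λ|`. [folklore] -/
theorem card_spinDownOrbitals {Λ : Type*} [LinearOrder Λ] [Fintype Λ] :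
    (spinDownOrbitals : Finset (Orb Λ)).card = Fintype.card Λ := by
  have h : (spinDownOrbitals : Finset (Orb Λ)) = Finset.univ.image fun x : Λ => orb x 1 := by
    ext o
    obtain ⟨⟨x, σ⟩, rfl⟩ : ∃ q : Λ × Fin 2, toLex q = o := ⟨ofLex o, toLex_ofLex o⟩
    change orb x σ ∈ _ ↔ orb x σ ∈ _
    rw [orb_mem_spinDownOrbitals_iff, Finset.mem_image]
    constructor
    · rintro rfl; exact ⟨x, Finset.mem_univ _, rfl⟩
    · rintro ⟨y, -, hy⟩; exact (orb_eq_orb_iff.mp hy).2.symm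
  rw [h, Finset.card_image_of_injective _ fun x y hxy => (orb_eq_orb_iff.mp hxy).1, Finset.card_univ]

end EnergySums

section GroundStates

/-- **The Rayleigh quotient in the diagonal picture**:
`Re ⟨ψ, H(φ) ψ⟩ = Σ_s (Σ_{o' ∈ s} e(o')) |(Vψ)(s)|² + (Σ_k ξ_k) ‖ψ‖²`. [folklore] -/
theorem re_star_dotProduct_sourcedSpinTwisted_mulVec (μ₀ h : ℝ) (φ : Fin 2 → ℝ)
    (ψ : Fock (Orb (FermionTorus 2 L))) :
    (star ψ ⬝ᵥ (sourcedSpinTwistedHubbardTorus L 0 μ₀ h φ *ᵥ ψ)).re =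
      ∑ s, (∑ o' ∈ s, bdgModeEnergy L μ₀ h φ o') * ‖(bdgV L μ₀ h φ *ᵥ ψ) s‖ ^ 2 +
        (∑ k : TorusSite 2 L, twistXi L μ₀ φ k) * RayleighBound.normSq ψ := by
  rw [sourcedSpinTwistedHubbardTorus_zero_mulVec, dotProduct_add, dotProduct_smul,
    RayleighBound.star_dotProduct_self_eq_normSq, ← RayleighBound.star_mulVec_dotProduct,
    sum_smul_numberAt_mulVec, Complex.add_re, smul_eq_mul, ← Complex.ofReal_mul, Complex.ofReal_re]
  congr 1
  simp only [dotProduct, Pi.star_apply, Complex.re_sum]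
  refine Finset.sum_congr rfl fun s _ => ?_
  rw [Complex.star_def, mul_left_comm, Complex.conj_mul', ← Complex.ofReal_pow, ← Complex.ofReal_mul,
    Complex.ofReal_re]

/-- `V` preserves the norm: `‖Vψ‖² = ‖ψ‖²`. [folklore] -/
theorem normSq_bdgV_mulVec (μ₀ h : ℝ) (φ : Fin 2 → ℝ) (ψ : Fock (Orb (FermionTorus 2 L))) :
    RayleighBound.normSq (bdgV L μ₀ h φ *ᵥ ψ) = RayleighBound.normSq ψ := by
  have h1 := star_bdgV_mulVec_dotProduct (L := L) μ₀ h φ ψ ψ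
  rw [RayleighBound.star_dotProduct_self_eq_normSq, RayleighBound.star_dotProduct_self_eq_normSq] at h1
  exact_mod_cast h1

/-- **The variational lower bound** `Re ⟨ψ, H(φ) ψ⟩ ≥ (Σ_{o' ∈ D↓} e(o') + Σ_k ξ_k) ‖ψ‖²`.
[folklore] -/
theorem re_star_dotProduct_sourcedSpinTwisted_mulVec_ge (μ₀ h : ℝ) (φ : Fin 2 → ℝ)
    (ψ : Fock (Orb (FermionTorus 2 L))) :
    ((∑ o' ∈ (spinDownOrbitals : Finset (Orb (FermionTorus 2 L))), bdgModeEnergy L μ₀ h φ o') +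
        ∑ k : TorusSite 2 L, twistXi L μ₀ φ k) * RayleighBound.normSq ψ ≤
      (star ψ ⬝ᵥ (sourcedSpinTwistedHubbardTorus L 0 μ₀ h φ *ᵥ ψ)).re := by
  rw [re_star_dotProduct_sourcedSpinTwisted_mulVec, add_mul, ← normSq_bdgV_mulVec μ₀ h φ ψ,
    RayleighBound.normSq, Finset.mul_sum]
  refine add_le_add (Finset.sum_le_sum fun s _ => ?_) le_rfl
  exact mul_le_mul_of_nonneg_right (sum_bdgModeEnergy_spinDownOrbitals_le μ₀ h φ s) (by positivity)


/-- `star e_s = e_s` for the occupation basis vector `e_s = Pi.single s 1`. [folklore] -/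
theorem star_single_one {ι : Type*} [DecidableEq ι] (s : ι) :
    star (Pi.single s (1 : ℂ) : ι → ℂ) = Pi.single s 1 := by
  ext t
  simp only [Pi.star_apply, Pi.single_apply]
  split_ifs <;> simp

/-- The pulled-back occupation basis vectors `Vᴴ e_s` are orthonormal. [folklore] -/
theorem star_bdgV_conjTranspose_single_dotProduct (μ₀ h : ℝ) (φ : Fin 2 → ℝ)
    (s t : Finset (Orb (FermionTorus 2 L))) :
    star ((bdgV L μ₀ h φ)ᴴ *ᵥ (Pi.single s 1 : Fock (Orb (FermionTorus 2 L)))) ⬝ᵥ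
        ((bdgV L μ₀ h φ)ᴴ *ᵥ (Pi.single t 1 : Fock (Orb (FermionTorus 2 L)))) =
      if s = t then 1 else 0 := by
  rw [star_bdgV_conjTranspose_mulVec_dotProduct, star_single_one, single_dotProduct, one_mul,
    Pi.single_apply]

/-- **`Vᴴ e_s` is an eigenvector of `H(φ)`** with eigenvalue `Σ_{o' ∈ s} e(o') + Σ_k ξ_k` (the
Bogoliubov quasiparticle configurations). de Gennes (1966) Ch. 5. [folklore] -/
theorem sourcedSpinTwisted_mulVec_bdgV_conjTranspose_single (μ₀ h : ℝ) (φ : Fin 2 → ℝ)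
    (s : Finset (Orb (FermionTorus 2 L))) :
    sourcedSpinTwistedHubbardTorus L 0 μ₀ h φ *ᵥ
        ((bdgV L μ₀ h φ)ᴴ *ᵥ (Pi.single s 1 : Fock (Orb (FermionTorus 2 L)))) =
      (((∑ o' ∈ s, bdgModeEnergy L μ₀ h φ o') + ∑ k : TorusSite 2 L, twistXi L μ₀ φ k : ℝ) : ℂ) •
        ((bdgV L μ₀ h φ)ᴴ *ᵥ (Pi.single s 1 : Fock (Orb (FermionTorus 2 L)))) := by
  rw [sourcedSpinTwistedHubbardTorus_zero_mulVec, bdgV_mulVec_conjTranspose_mulVec,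
    sum_smul_numberAt_mulVec]
  have hD : (fun t => (((∑ o' ∈ t, bdgModeEnergy L μ₀ h φ o' : ℝ)) : ℂ) *
      (Pi.single s (1 : ℂ) : Fock (Orb (FermionTorus 2 L))) t) =
      (((∑ o' ∈ s, bdgModeEnergy L μ₀ h φ o' : ℝ)) : ℂ) • (Pi.single s 1 : Fock (Orb (FermionTorus 2 L))) := by
    funext t
    rw [Pi.smul_apply, Pi.single_apply, smul_eq_mul]
    split_ifs with ht
    · subst ht; rfl
    · rw [mul_zero, mul_zero]
  rw [hD, mulVec_smul, Complex.ofReal_add, add_smul]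

/-- `Vᴴ e_s` lies in `ker S^z` iff `|s| = L²`. [folklore] -/
theorem spinZ_mulVec_bdgV_conjTranspose_single_eq_zero_iff (μ₀ h : ℝ) (φ : Fin 2 → ℝ)
    (s : Finset (Orb (FermionTorus 2 L))) :
    HubbardWave0.spinZ *ᵥ ((bdgV L μ₀ h φ)ᴴ *ᵥ (Pi.single s 1 : Fock (Orb (FermionTorus 2 L)))) = 0 ↔
      s.card = Fintype.card (FermionTorus 2 L) := by
  rw [spinZ_mulVec_eq_zero_iff μ₀ h φ, bdgV_mulVec_conjTranspose_mulVec]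
  constructor
  · intro hN
    by_contra hs
    have h1 := hN s hs
    rw [Pi.single_eq_same] at h1
    exact one_ne_zero h1
  · intro hs t ht
    rw [Pi.single_apply, if_neg]
    rintro rfl
    exact ht hs

/-- **The sector ground-state energy**: on `ker S^z` the lowest energy of `H(φ)` is
`Σ_{o' ∈ D↓} e(o') + Σ_k ξ_k = Σ_k (ξ_k - |z_k|)` (the BCS ground-state energy; it is attained by
`Vᴴ e_{D↓}`, which has `|D↓| = L²` particles after the transformation). de Gennes (1966) Ch. 5.
[folklore] -/
theorem minEnergyOn_sourcedSpinTwisted_ker_spinZ (μ₀ h : ℝ) (φ : Fin 2 → ℝ) :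
    (sourcedSpinTwistedHubbardTorus L 0 μ₀ h φ).minEnergyOn
        (LinearMap.ker (Matrix.toLin' (HubbardWave0.spinZ :
          Matrix (Finset (Orb (FermionTorus 2 L))) (Finset (Orb (FermionTorus 2 L))) ℂ))) =
      (∑ o' ∈ (spinDownOrbitals : Finset (Orb (FermionTorus 2 L))), bdgModeEnergy L μ₀ h φ o') +
        ∑ k : TorusSite 2 L, twistXi L μ₀ φ k := by
  apply IsLeast.csInf_eq
  constructor
  · refine ⟨(bdgV L μ₀ h φ)ᴴ *ᵥ (Pi.single spinDownOrbitals 1 : Fock (Orb (FermionTorus 2 L))),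
      ?_, ?_, ?_⟩
    · rw [LinearMap.mem_ker, Matrix.toLin'_apply, spinZ_mulVec_bdgV_conjTranspose_single_eq_zero_iff,
        card_spinDownOrbitals]
    · rw [star_bdgV_conjTranspose_single_dotProduct, if_pos rfl]
    · rw [sourcedSpinTwisted_mulVec_bdgV_conjTranspose_single, dotProduct_smul,
        star_bdgV_conjTranspose_single_dotProduct, if_pos rfl, smul_eq_mul, mul_one, Complex.ofReal_re]
  · rintro E ⟨ψ, -, hnorm, rfl⟩
    have h1 := re_star_dotProduct_sourcedSpinTwisted_mulVec_ge (L := L) μ₀ h φ ψ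
    have h2 : RayleighBound.normSq ψ = 1 := by
      rw [RayleighBound.star_dotProduct_self_eq_normSq] at hnorm
      exact_mod_cast hnorm
    rwa [h2, mul_one] at h1

/-- **Ground states in the diagonal picture.** `H(φ) ψ = E₀ ψ` with the sector ground-state energy
`E₀ = Σ_{o' ∈ D↓} e(o') + Σ_k ξ_k` iff `Vψ` is supported on the minimising configurations
(`Σ_{o' ∈ s} e(o') = Σ_{o' ∈ D↓} e(o')`). [folklore] -/
theorem sourcedSpinTwisted_mulVec_eq_smul_iff (μ₀ h : ℝ) (φ : Fin 2 → ℝ)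
    (ψ : Fock (Orb (FermionTorus 2 L))) :
    sourcedSpinTwistedHubbardTorus L 0 μ₀ h φ *ᵥ ψ =
        ((((∑ o' ∈ (spinDownOrbitals : Finset (Orb (FermionTorus 2 L))), bdgModeEnergy L μ₀ h φ o') +
          ∑ k : TorusSite 2 L, twistXi L μ₀ φ k : ℝ)) : ℂ) • ψ ↔
      ∀ s, ∑ o' ∈ s, bdgModeEnergy L μ₀ h φ o' ≠
          ∑ o' ∈ (spinDownOrbitals : Finset (Orb (FermionTorus 2 L))), bdgModeEnergy L μ₀ h φ o' →
        (bdgV L μ₀ h φ *ᵥ ψ) s = 0 := by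
  set E₀ : ℝ := ∑ o' ∈ (spinDownOrbitals : Finset (Orb (FermionTorus 2 L))), bdgModeEnergy L μ₀ h φ o'
    with hE₀
  set D := ∑ o' : Orb (FermionTorus 2 L), ((bdgModeEnergy L μ₀ h φ o' : ℝ) : ℂ) • numberAt o' with hD
  -- `H ψ = E ψ ↔ D Vψ = E₀ Vψ`
  have key : sourcedSpinTwistedHubbardTorus L 0 μ₀ h φ *ᵥ ψ =
      (((E₀ + ∑ k : TorusSite 2 L, twistXi L μ₀ φ k : ℝ)) : ℂ) • ψ ↔
      D *ᵥ (bdgV L μ₀ h φ *ᵥ ψ) = (E₀ : ℂ) • (bdgV L μ₀ h φ *ᵥ ψ) := by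
    rw [sourcedSpinTwistedHubbardTorus_zero_mulVec, ← hD, Complex.ofReal_add, add_smul, add_left_inj]
    constructor
    · intro h1
      have h2 := congrArg (fun χ => bdgV L μ₀ h φ *ᵥ χ) h1
      simp only [bdgV_mulVec_conjTranspose_mulVec, mulVec_smul] at h2
      exact h2
    · intro h1
      rw [h1, mulVec_smul, bdgV_conjTranspose_mulVec_mulVec]
  rw [key, hD, sum_smul_numberAt_mulVec, funext_iff]
  refine forall_congr' fun s => ?_
  rw [Pi.smul_apply, smul_eq_mul, ← sub_eq_zero, ← sub_mul, mul_eq_zero, sub_eq_zero,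
    Complex.ofReal_inj, or_iff_not_imp_left]


omit [NeZero L] in
/-- In the non-degenerate case (no zero-energy Bogoliubov mode) the filled lower band is the only
minimising configuration. [folklore] -/
theorem eq_spinDownOrbitals_of_sum_bdgModeEnergy_eq {μ₀ h : ℝ} {φ : Fin d → ℝ}
    (hz : ∀ x : FermionTorus d L, twistNambuZ L μ₀ h φ x.toTorusSite ≠ 0)
    {s : Finset (Orb (FermionTorus d L))}
    (hs : ∑ o' ∈ s, bdgModeEnergy L μ₀ h φ o' =
      ∑ o' ∈ (spinDownOrbitals : Finset (Orb (FermionTorus d L))), bdgModeEnergy L μ₀ h φ o') :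
    s = spinDownOrbitals := by
  rw [sum_bdgModeEnergy_eq_iff] at hs
  ext o
  obtain ⟨⟨x, σ⟩, rfl⟩ : ∃ q : FermionTorus d L × Fin 2, toLex q = o := ⟨ofLex o, toLex_ofLex o⟩
  change orb x σ ∈ s ↔ orb x σ ∈ _
  rw [orb_mem_spinDownOrbitals_iff]
  fin_cases σ
  · simp only [Fin.zero_eta, zero_ne_one, iff_false]
    exact fun h0 => hz x ((hs x).1 h0)
  · simp only [Fin.mk_one, iff_true]
    by_contra h1
    exact hz x ((hs x).2 h1)

/-- **Uniqueness of the ground state in the non-degenerate case**: if no Bogoliubov mode has zero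
energy, every solution of `H(φ) ψ = E₀ ψ` is a multiple of `Vᴴ e_{D↓}` (the BCS state).
de Gennes (1966) Ch. 5. [folklore] -/
theorem eq_smul_bcs_of_forall_twistNambuZ_ne_zero {μ₀ h : ℝ} {φ : Fin 2 → ℝ}
    (hz : ∀ x : FermionTorus 2 L, twistNambuZ L μ₀ h φ x.toTorusSite ≠ 0)
    {ψ : Fock (Orb (FermionTorus 2 L))}
    (hψ : sourcedSpinTwistedHubbardTorus L 0 μ₀ h φ *ᵥ ψ =
      ((((∑ o' ∈ (spinDownOrbitals : Finset (Orb (FermionTorus 2 L))), bdgModeEnergy L μ₀ h φ o') +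
        ∑ k : TorusSite 2 L, twistXi L μ₀ φ k : ℝ)) : ℂ) • ψ) :
    ψ = (bdgV L μ₀ h φ *ᵥ ψ) spinDownOrbitals •
      ((bdgV L μ₀ h φ)ᴴ *ᵥ (Pi.single spinDownOrbitals 1 : Fock (Orb (FermionTorus 2 L)))) := by
  rw [sourcedSpinTwisted_mulVec_eq_smul_iff] at hψ
  have hV : bdgV L μ₀ h φ *ᵥ ψ = (bdgV L μ₀ h φ *ᵥ ψ) spinDownOrbitals •
      (Pi.single spinDownOrbitals 1 : Fock (Orb (FermionTorus 2 L))) := by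
    funext t
    rw [Pi.smul_apply, Pi.single_apply, smul_eq_mul]
    split_ifs with ht
    · rw [ht, mul_one]
    · rw [mul_zero]
      exact hψ t fun h' => ht (eq_spinDownOrbitals_of_sum_bdgModeEnergy_eq hz h')
  calc ψ = (bdgV L μ₀ h φ)ᴴ *ᵥ (bdgV L μ₀ h φ *ᵥ ψ) := (bdgV_conjTranspose_mulVec_mulVec μ₀ h φ ψ).symm
    _ = _ := by
        conv_lhs => rw [hV]
        rw [mulVec_smul]

/-- **Degeneracy at a zero-energy mode**: if `z_{x̄} = 0` for some site label `x`, then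
`Vᴴ e_{D↓}` and `Vᴴ e_{D↓ ∖ (x,↓) ∪ (x,↑)}` are two orthogonal, normalised solutions of
`H(φ) ψ = E₀ ψ` in `ker S^z`. [folklore] -/
theorem exists_orthogonal_ground_states_of_twistNambuZ_eq_zero {μ₀ h : ℝ} {φ : Fin 2 → ℝ}
    (x : FermionTorus 2 L) (hx : twistNambuZ L μ₀ h φ x.toTorusSite = 0) :
    ∃ ψ₁ ψ₂ : Fock (Orb (FermionTorus 2 L)),
      (HubbardWave0.spinZ *ᵥ ψ₁ = 0 ∧ star ψ₁ ⬝ᵥ ψ₁ = 1 ∧ sourcedSpinTwistedHubbardTorus L 0 μ₀ h φ *ᵥ ψ₁ =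
        ((((∑ o' ∈ (spinDownOrbitals : Finset (Orb (FermionTorus 2 L))), bdgModeEnergy L μ₀ h φ o') +
          ∑ k : TorusSite 2 L, twistXi L μ₀ φ k : ℝ)) : ℂ) • ψ₁) ∧
      (HubbardWave0.spinZ *ᵥ ψ₂ = 0 ∧ star ψ₂ ⬝ᵥ ψ₂ = 1 ∧ sourcedSpinTwistedHubbardTorus L 0 μ₀ h φ *ᵥ ψ₂ =
        ((((∑ o' ∈ (spinDownOrbitals : Finset (Orb (FermionTorus 2 L))), bdgModeEnergy L μ₀ h φ o') +
          ∑ k : TorusSite 2 L, twistXi L μ₀ φ k : ℝ)) : ℂ) • ψ₂) ∧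
      star ψ₁ ⬝ᵥ ψ₂ = 0 := by
  set s₀ : Finset (Orb (FermionTorus 2 L)) := spinDownOrbitals with hs₀
  set s₁ : Finset (Orb (FermionTorus 2 L)) := insert (orb x 0) (s₀.erase (orb x 1)) with hs₁
  have h0 : orb x 0 ∉ s₀.erase (orb x 1) := fun h' =>
    orb_zero_not_mem_spinDownOrbitals x (Finset.mem_of_mem_erase h')
  have h1 : orb x 1 ∈ s₀ := orb_one_mem_spinDownOrbitals x
  have hcard : s₁.card = s₀.card := by
    rw [hs₁, Finset.card_insert_of_notMem h0, Finset.card_erase_of_mem h1]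
    have := Finset.card_pos.mpr ⟨_, h1⟩
    omega
  have hne : s₀ ≠ s₁ := by
    intro h'
    have : orb x 0 ∈ s₀ := by rw [h']; exact Finset.mem_insert_self _ _
    exact orb_zero_not_mem_spinDownOrbitals x this
  have hE : ∑ o' ∈ s₁, bdgModeEnergy L μ₀ h φ o' = ∑ o' ∈ s₀, bdgModeEnergy L μ₀ h φ o' := by
    rw [hs₀, sum_bdgModeEnergy_eq_iff]
    intro y
    constructor
    · intro hy
      rw [hs₁, Finset.mem_insert] at hy
      rcases hy with hy | hy
      · rw [(orb_eq_orb_iff.mp hy).1]; exact hx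
      · exact absurd (Finset.mem_of_mem_erase hy) (orb_zero_not_mem_spinDownOrbitals y)
    · intro hy
      rw [hs₁, Finset.mem_insert, not_or, Finset.mem_erase, not_and_or, not_not] at hy
      rcases hy.2 with hy' | hy'
      · rw [(orb_eq_orb_iff.mp hy').1]; exact hx
      · exact absurd (orb_one_mem_spinDownOrbitals y) hy'
  refine ⟨(bdgV L μ₀ h φ)ᴴ *ᵥ (Pi.single s₀ 1 : Fock (Orb (FermionTorus 2 L))),
    (bdgV L μ₀ h φ)ᴴ *ᵥ (Pi.single s₁ 1 : Fock (Orb (FermionTorus 2 L))), ⟨?_, ?_, ?_⟩, ⟨?_, ?_, ?_⟩, ?_⟩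
  · rw [spinZ_mulVec_bdgV_conjTranspose_single_eq_zero_iff, hs₀, card_spinDownOrbitals]
  · rw [star_bdgV_conjTranspose_single_dotProduct, if_pos rfl]
  · rw [sourcedSpinTwisted_mulVec_bdgV_conjTranspose_single]
  · rw [spinZ_mulVec_bdgV_conjTranspose_single_eq_zero_iff, hcard, hs₀, card_spinDownOrbitals]
  · rw [star_bdgV_conjTranspose_single_dotProduct, if_pos rfl]
  · rw [sourcedSpinTwisted_mulVec_bdgV_conjTranspose_single, hE]
  · rw [star_bdgV_conjTranspose_single_dotProduct, if_neg hne]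

end GroundStates

end Summit.HubbardSuperconductivity.HubbardSuperconductivity.Theorems.NodalDiracTwist
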